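import Summits.RiemannHypothesis.RiemannHypothesis.Theorems.WeilFormatCMixedArchAsymptotics
import HarnessLib

/-!
# Format C, design C∞: the archimedean node sums expanded in powers of `1/ω` to ANY order

Route context: Fourier–Galerkin / Schur-complement certificates of Weil positivity on a window ("format C";
cell memo `run/shared/lean/pub/rh-explicit/rh-explicit-weil-10/KERNEL-LEVER.md` §20; supporting stmt-RiemannHypothesis-0098;
seat rh-explicit-weil-10).  Besides `ψ(¼ + iω/2)` (`WeilFormatCDigammaQuarterExpansion`) the archimedean families
`J_s(m) = ½ Im ψ(¼+iω_m/2) − T_s(ω_m)` and `J_c(m) = ½(Re ψ(¼+iω_m/2) − ψ(¼)) − Σ_k e^{−2al_k}/l_k + T_c(ω_m)`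
(`setIntegral_weilArchDensity_mul_sin`, `tsum_exp_mul_digammaTerm_div_two_eq`) contain the node sums

  `T_s(ω) = Σ_k e^{−2al_k} ω/(l_k² + ω²)`,   `T_c(ω) = Σ_k e^{−2al_k} l_k/(l_k² + ω²)`   (`l_k = 2k + ½`).

Expanding `1/(1 + l²/ω²)` geometrically (`geom_sum_mul_neg`) gives them as polynomials in `1/ω` whose coefficients are the
NODE MOMENTS `D_s(a) = Σ_k e^{−2al_k} l_k^s`, with explicit remainders:

* `summable_exp_mul_node_pow`, `tsum_exp_mul_node_pow_le` — `D_s` converges, `D_s ≤ s!·a^{−s}·ρ(a)` (`l^s e^{−al} ≤ s!/a^s`);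
* `abs_tsum_sub_sum_tsum_le` — generic: termwise expansions with remainders sum to an expansion with the summed remainder;
* `abs_nodeSumSin_sub_sum_le` — `|T_s(ω) − Σ_{r<R} (−1)^r D_{2r}/ω^{2r+1}| ≤ D_{2R}/|ω|^{2R+1}`;
* `abs_nodeSumCos_sub_sum_le` — `|T_c(ω) − Σ_{r<R} (−1)^r D_{2r+1}/ω^{2r+2}| ≤ D_{2R+1}/|ω|^{2R+2}`;
* `tsum_exp_mul_node_pow_sub_sum_le` — enclosure of `D_s` by partial sums: if `e^{−4a}(1 + 2/l_K)^s ≤ ½` then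
  `0 ≤ D_s − Σ_{k<K} e^{−2al_k} l_k^s ≤ 2 e^{−2al_K} l_K^s`;
* `I_pow_eq_I_pow_mod_four`, `re_I_mul_ofReal_pow`, `im_I_mul_ofReal_pow` — real/imaginary parts of the expansion variable `(it)ⁿ`.

Pure real analysis; standard axioms; no definitions; no RH claim.
-/

set_option autoImplicit false
-- `Summit.RiemannHypothesis.RiemannHypothesis.…` is the layout-mandated namespace (summit = problem name).
set_option linter.dupNamespace false

noncomputable section

open Filter Finset
open scoped Real Topology

namespace Summit.RiemannHypothesis.RiemannHypothesis.Theorems.WeilFormatC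

open Literature.NumberTheory.LFunctions Literature.Analysis.SpecialFunctions

variable {a : ℝ}

/-! ## The node moments `D_s(a) = Σ_k e^{−2al_k} l_k^s` -/

/-- `l^s e^{−al} ≤ s!/a^s` for `l ≥ 0`, `a > 0` (from `(al)^s/s! ≤ e^{al}`). -/
theorem pow_mul_exp_neg_mul_le_factorial_div (ha : 0 < a) {l : ℝ} (hl : 0 ≤ l) (s : ℕ) :
    l ^ s * Real.exp (-(a * l)) ≤ (s.factorial : ℝ) / a ^ s := by
  have h := Real.pow_div_factorial_le_exp (x := a * l) (by positivity) s
  have hfac : (0 : ℝ) < s.factorial := by exact_mod_cast Nat.factorial_pos s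
  have has : 0 < a ^ s := by positivity
  rw [mul_pow, div_le_iff₀ hfac] at h
  rw [Real.exp_neg, le_div_iff₀ has]
  have hexp : 0 < Real.exp (a * l) := Real.exp_pos _
  calc l ^ s * (Real.exp (a * l))⁻¹ * a ^ s = (a ^ s * l ^ s) / Real.exp (a * l) := by
        rw [div_eq_mul_inv]; ring
    _ ≤ (Real.exp (a * l) * s.factorial) / Real.exp (a * l) := div_le_div_of_nonneg_right h hexp.le
    _ = (s.factorial : ℝ) := by field_simp

/-- Termwise bound: `e^{−2al_k} l_k^s ≤ (s!/a^s)·e^{−l_k a}`. -/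
theorem exp_mul_node_pow_le (ha : 0 < a) (s k : ℕ) :
    Real.exp (-(2 * a * digammaNode k)) * digammaNode k ^ s
      ≤ (s.factorial : ℝ) / a ^ s * Real.exp (-(digammaNode k * a)) := by
  have hl := digammaNode_pos k
  have h := pow_mul_exp_neg_mul_le_factorial_div ha hl.le s
  have e : Real.exp (-(2 * a * digammaNode k)) * digammaNode k ^ s
      = Real.exp (-(digammaNode k * a)) * (digammaNode k ^ s * Real.exp (-(a * digammaNode k))) := by
    rw [show -(2 * a * digammaNode k) = -(digammaNode k * a) + -(a * digammaNode k) by ring, Real.exp_add]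
    ring
  rw [e, mul_comm ((s.factorial : ℝ) / a ^ s)]
  exact mul_le_mul_of_nonneg_left h (Real.exp_pos _).le

/-- **The node moments converge**: `Σ_k e^{−2al_k} l_k^s` is summable (`a > 0`). -/
theorem summable_exp_mul_node_pow (ha : 0 < a) (s : ℕ) :
    Summable fun k : ℕ ↦ Real.exp (-(2 * a * digammaNode k)) * digammaNode k ^ s := by
  have hρ := (hasSum_exp_neg_digammaNode_mul (t := a) ha).summable.mul_left ((s.factorial : ℝ) / a ^ s)
  refine Summable.of_nonneg_of_le (fun k ↦ ?_) (fun k ↦ exp_mul_node_pow_le ha s k) hρ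
  have := digammaNode_pos k; positivity

/-- **Crude bound of the node moments**: `Σ_k e^{−2al_k} l_k^s ≤ (s!/a^s)·ρ(a)` (`ρ(a) = Σ_k e^{−al_k} = weilArchDensity a`). -/
theorem tsum_exp_mul_node_pow_le (ha : 0 < a) (s : ℕ) :
    ∑' k : ℕ, Real.exp (-(2 * a * digammaNode k)) * digammaNode k ^ s
      ≤ (s.factorial : ℝ) / a ^ s * weilArchDensity a := by
  have hρ := (hasSum_exp_neg_digammaNode_mul (t := a) ha).mul_left ((s.factorial : ℝ) / a ^ s)
  calc ∑' k : ℕ, Real.exp (-(2 * a * digammaNode k)) * digammaNode k ^ s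
      ≤ ∑' k : ℕ, (s.factorial : ℝ) / a ^ s * Real.exp (-(digammaNode k * a)) :=
        (summable_exp_mul_node_pow ha s).tsum_le_tsum (fun k ↦ exp_mul_node_pow_le ha s k) hρ.summable
    _ = (s.factorial : ℝ) / a ^ s * weilArchDensity a := hρ.tsum_eq

/-- The node moments are nonnegative. -/
theorem tsum_exp_mul_node_pow_nonneg (a : ℝ) (s : ℕ) :
    0 ≤ ∑' k : ℕ, Real.exp (-(2 * a * digammaNode k)) * digammaNode k ^ s :=
  tsum_nonneg fun k ↦ by have := digammaNode_pos k; positivity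

/-! ## One node -/

/-- **Finite geometric expansion with remainder**: for `q ≥ 0`, `1/(1+q) = Σ_{r<R} (−q)^r + (−q)^R/(1+q)`. -/
theorem one_div_one_add_eq_sum_add {q : ℝ} (hq : 0 ≤ q) (R : ℕ) :
    1 / (1 + q) = ∑ r ∈ Finset.range R, (-q) ^ r + (-q) ^ R / (1 + q) := by
  have h1q : (1 : ℝ) + q ≠ 0 := by positivity
  have h := geom_sum_mul_neg (-q) R
  rw [sub_neg_eq_add] at h
  have hs : ∑ r ∈ Finset.range R, (-q) ^ r = (1 - (-q) ^ R) / (1 + q) := by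
    rw [eq_div_iff h1q]; exact h
  rw [hs, ← add_div]
  congr 1
  ring

/-- **One node of `T_s`**: `|ω/(l²+ω²) − Σ_{r<R} (−1)^r l^{2r}/ω^{2r+1}| ≤ l^{2R}/|ω|^{2R+1}` (`ω ≠ 0`, `l > 0`). -/
theorem abs_freq_div_sub_sum_le {ω l : ℝ} (hω : ω ≠ 0) (hl : 0 < l) (R : ℕ) :
    |ω / (l ^ 2 + ω ^ 2) - ∑ r ∈ Finset.range R, (-1 : ℝ) ^ r * l ^ (2 * r) / ω ^ (2 * r + 1)|
      ≤ l ^ (2 * R) / |ω| ^ (2 * R + 1) := by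
  set q : ℝ := l ^ 2 / ω ^ 2 with hq
  have hω2 : 0 < ω ^ 2 := by positivity
  have hq0 : 0 ≤ q := by positivity
  have hgeo := one_div_one_add_eq_sum_add hq0 R
  have h1 : ω / (l ^ 2 + ω ^ 2) = (1 / ω) * (1 / (1 + q)) := by
    rw [hq]; field_simp; ring
  have hterm : ∀ r : ℕ, (1 / ω) * (-q) ^ r = (-1 : ℝ) ^ r * l ^ (2 * r) / ω ^ (2 * r + 1) := by
    intro r
    rw [hq, neg_pow, div_pow, ← pow_mul, ← pow_mul, pow_succ]
    field_simp
  have hdiff : ω / (l ^ 2 + ω ^ 2) - ∑ r ∈ Finset.range R, (-1 : ℝ) ^ r * l ^ (2 * r) / ω ^ (2 * r + 1)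
      = (1 / ω) * ((-q) ^ R / (1 + q)) := by
    rw [h1, hgeo, mul_add, Finset.mul_sum, Finset.sum_congr rfl fun r _ ↦ hterm r]
    ring
  have hωpow : ω ^ (2 * R) = |ω| ^ (2 * R) := ((even_two_mul R).pow_abs ω).symm
  have hqR : q ^ R = l ^ (2 * R) / |ω| ^ (2 * R) := by
    rw [hq, div_pow, ← pow_mul, ← pow_mul, hωpow]
  rw [hdiff, abs_mul, abs_div, abs_one, abs_div, abs_pow, abs_neg, abs_of_nonneg hq0,
    abs_of_pos (by positivity : (0 : ℝ) < 1 + q)]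
  have hωa : 0 < |ω| := abs_pos.2 hω
  calc 1 / |ω| * (q ^ R / (1 + q)) ≤ 1 / |ω| * q ^ R := by
        refine mul_le_mul_of_nonneg_left (div_le_self (pow_nonneg hq0 R) (by linarith)) (by positivity)
    _ = l ^ (2 * R) / |ω| ^ (2 * R + 1) := by
        rw [hqR, div_mul_div_comm, one_mul]
        congr 1
        ring

/-- **One node of `T_c`**: `|l/(l²+ω²) − Σ_{r<R} (−1)^r l^{2r+1}/ω^{2r+2}| ≤ l^{2R+1}/|ω|^{2R+2}` (`ω ≠ 0`, `l > 0`). -/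
theorem abs_node_div_sub_sum_le {ω l : ℝ} (hω : ω ≠ 0) (hl : 0 < l) (R : ℕ) :
    |l / (l ^ 2 + ω ^ 2) - ∑ r ∈ Finset.range R, (-1 : ℝ) ^ r * l ^ (2 * r + 1) / ω ^ (2 * r + 2)|
      ≤ l ^ (2 * R + 1) / |ω| ^ (2 * R + 2) := by
  set q : ℝ := l ^ 2 / ω ^ 2 with hq
  have hω2 : 0 < ω ^ 2 := by positivity
  have hq0 : 0 ≤ q := by positivity
  have hgeo := one_div_one_add_eq_sum_add hq0 R
  have h1 : l / (l ^ 2 + ω ^ 2) = (l / ω ^ 2) * (1 / (1 + q)) := by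
    rw [hq]; field_simp; ring
  have hterm : ∀ r : ℕ, (l / ω ^ 2) * (-q) ^ r = (-1 : ℝ) ^ r * l ^ (2 * r + 1) / ω ^ (2 * r + 2) := by
    intro r
    rw [hq, neg_pow, div_pow, ← pow_mul, ← pow_mul, pow_succ, pow_add]
    field_simp
    ring
  have hdiff : l / (l ^ 2 + ω ^ 2) - ∑ r ∈ Finset.range R, (-1 : ℝ) ^ r * l ^ (2 * r + 1) / ω ^ (2 * r + 2)
      = (l / ω ^ 2) * ((-q) ^ R / (1 + q)) := by
    rw [h1, hgeo, mul_add, Finset.mul_sum, Finset.sum_congr rfl fun r _ ↦ hterm r]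
    ring
  have hωpow : ω ^ (2 * R) = |ω| ^ (2 * R) := ((even_two_mul R).pow_abs ω).symm
  have hqR : q ^ R = l ^ (2 * R) / |ω| ^ (2 * R) := by
    rw [hq, div_pow, ← pow_mul, ← pow_mul, hωpow]
  rw [hdiff, abs_mul, abs_div, abs_div, abs_pow, abs_pow, abs_neg, abs_of_nonneg hq0, abs_of_pos hl,
    abs_of_pos (by positivity : (0 : ℝ) < 1 + q)]
  have hωa : 0 < |ω| := abs_pos.2 hω
  calc l / |ω| ^ 2 * (q ^ R / (1 + q)) ≤ l / |ω| ^ 2 * q ^ R := by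
        refine mul_le_mul_of_nonneg_left (div_le_self (pow_nonneg hq0 R) (by linarith)) (by positivity)
    _ = l ^ (2 * R + 1) / |ω| ^ (2 * R + 2) := by
        rw [hqR, div_mul_div_comm]
        congr 1 <;> ring

/-! ## Summing termwise expansions -/

/-- **Generic**: if every node satisfies `|φ_k − Σ_{r<R} ψ_{r,k}| ≤ M_k` and `e ≥ 0`, with `e·φ`, `e·ψ_r`, `e·M` summable, then
`|Σ'_k e_kφ_k − Σ_{r<R} Σ'_k e_kψ_{r,k}| ≤ Σ'_k e_kM_k`. -/
theorem abs_tsum_sub_sum_tsum_le (e φ M : ℕ → ℝ) (ψ : ℕ → ℕ → ℝ) (R : ℕ) (he : ∀ k, 0 ≤ e k)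
    (hφ : Summable fun k ↦ e k * φ k) (hψ : ∀ r, Summable fun k ↦ e k * ψ r k) (hM : Summable fun k ↦ e k * M k)
    (hrem : ∀ k, |φ k - ∑ r ∈ Finset.range R, ψ r k| ≤ M k) :
    |(∑' k : ℕ, e k * φ k) - ∑ r ∈ Finset.range R, ∑' k : ℕ, e k * ψ r k| ≤ ∑' k : ℕ, e k * M k := by
  have hsumψ : Summable fun k ↦ ∑ r ∈ Finset.range R, e k * ψ r k := summable_sum fun r _ ↦ hψ r
  have hswap : ∑ r ∈ Finset.range R, ∑' k : ℕ, e k * ψ r k = ∑' k : ℕ, ∑ r ∈ Finset.range R, e k * ψ r k :=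
    (Summable.tsum_finsetSum fun r _ ↦ hψ r).symm
  rw [hswap, ← hφ.tsum_sub hsumψ]
  have hterm : ∀ k, |e k * φ k - ∑ r ∈ Finset.range R, e k * ψ r k| ≤ e k * M k := by
    intro k
    rw [← Finset.mul_sum, ← mul_sub, abs_mul, abs_of_nonneg (he k)]
    exact mul_le_mul_of_nonneg_left (hrem k) (he k)
  have habs : Summable fun k ↦ |e k * φ k - ∑ r ∈ Finset.range R, e k * ψ r k| :=
    Summable.of_nonneg_of_le (fun k ↦ abs_nonneg _) hterm hM
  calc |∑' k : ℕ, (e k * φ k - ∑ r ∈ Finset.range R, e k * ψ r k)|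
      ≤ ∑' k : ℕ, |e k * φ k - ∑ r ∈ Finset.range R, e k * ψ r k| := by
        have h := norm_tsum_le_tsum_norm (f := fun k ↦ e k * φ k - ∑ r ∈ Finset.range R, e k * ψ r k)
          (by simpa only [Real.norm_eq_abs] using habs)
        simpa only [Real.norm_eq_abs] using h
    _ ≤ ∑' k : ℕ, e k * M k := habs.tsum_le_tsum hterm hM

/-- **`T_s` expanded**: for `a > 0`, `ω ≠ 0` and every `R`,
`|Σ_k e^{−2al_k} ω/(l_k²+ω²) − Σ_{r<R} (−1)^r D_{2r}(a)/ω^{2r+1}| ≤ D_{2R}(a)/|ω|^{2R+1}`, `D_s = Σ_k e^{−2al_k} l_k^s`. -/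
theorem abs_nodeSumSin_sub_sum_le (ha : 0 < a) {ω : ℝ} (hω : ω ≠ 0) (R : ℕ) :
    |(∑' k : ℕ, Real.exp (-(2 * a * digammaNode k)) * (ω / (digammaNode k ^ 2 + ω ^ 2)))
        - ∑ r ∈ Finset.range R, (-1 : ℝ) ^ r * (∑' k : ℕ, Real.exp (-(2 * a * digammaNode k)) * digammaNode k ^ (2 * r))
            / ω ^ (2 * r + 1)|
      ≤ (∑' k : ℕ, Real.exp (-(2 * a * digammaNode k)) * digammaNode k ^ (2 * R)) / |ω| ^ (2 * R + 1) := by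
  have hωa : 0 < |ω| := abs_pos.2 hω
  -- rewrite the coefficient sums as series of the termwise expansions
  have hψsum : ∀ r : ℕ, Summable fun k ↦ Real.exp (-(2 * a * digammaNode k)) *
      ((-1 : ℝ) ^ r * digammaNode k ^ (2 * r) / ω ^ (2 * r + 1)) := by
    intro r
    refine ((summable_exp_mul_node_pow ha (2 * r)).mul_left ((-1 : ℝ) ^ r / ω ^ (2 * r + 1))).congr fun k ↦ ?_
    ring
  have hcoef : ∀ r : ℕ, (-1 : ℝ) ^ r * (∑' k : ℕ, Real.exp (-(2 * a * digammaNode k)) * digammaNode k ^ (2 * r))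
        / ω ^ (2 * r + 1)
      = ∑' k : ℕ, Real.exp (-(2 * a * digammaNode k)) * ((-1 : ℝ) ^ r * digammaNode k ^ (2 * r) / ω ^ (2 * r + 1)) := by
    intro r
    rw [← tsum_mul_left, ← tsum_div_const]
    exact tsum_congr fun k ↦ by ring
  rw [Finset.sum_congr rfl fun r _ ↦ hcoef r]
  have hM : Summable fun k ↦ Real.exp (-(2 * a * digammaNode k)) * (digammaNode k ^ (2 * R) / |ω| ^ (2 * R + 1)) := by
    refine ((summable_exp_mul_node_pow ha (2 * R)).div_const (|ω| ^ (2 * R + 1))).congr fun k ↦ ?_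
    ring
  have h := abs_tsum_sub_sum_tsum_le (fun k ↦ Real.exp (-(2 * a * digammaNode k)))
    (fun k ↦ ω / (digammaNode k ^ 2 + ω ^ 2)) (fun k ↦ digammaNode k ^ (2 * R) / |ω| ^ (2 * R + 1))
    (fun r k ↦ (-1 : ℝ) ^ r * digammaNode k ^ (2 * r) / ω ^ (2 * r + 1)) R (fun k ↦ (Real.exp_pos _).le)
    (by
      have h := summable_exp_mul_node_div ha ω
      -- `ω/(l²+ω²) = ω · (l/(l²+ω²)) / l`? use the bound `|ω/(l²+ω²)| ≤ 1/(2 l) ≤ 1` instead: bounded sequence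
      exact summable_exp_neg_mul_of_bounded ha (C := |ω| / ω ^ 2) fun k ↦ by
        have hl := digammaNode_pos k
        rw [abs_div, abs_of_pos (by positivity : (0 : ℝ) < digammaNode k ^ 2 + ω ^ 2)]
        exact div_le_div_of_nonneg_left (abs_nonneg _) (by positivity) (by nlinarith))
    hψsum hM (fun k ↦ abs_freq_div_sub_sum_le hω (digammaNode_pos k) R)
  refine h.trans (le_of_eq ?_)
  rw [← tsum_div_const]
  exact tsum_congr fun k ↦ by ring

/-- **`T_c` expanded**: for `a > 0`, `ω ≠ 0` and every `R`,
`|Σ_k e^{−2al_k} l_k/(l_k²+ω²) − Σ_{r<R} (−1)^r D_{2r+1}(a)/ω^{2r+2}| ≤ D_{2R+1}(a)/|ω|^{2R+2}`. -/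
theorem abs_nodeSumCos_sub_sum_le (ha : 0 < a) {ω : ℝ} (hω : ω ≠ 0) (R : ℕ) :
    |(∑' k : ℕ, Real.exp (-(2 * a * digammaNode k)) * (digammaNode k / (digammaNode k ^ 2 + ω ^ 2)))
        - ∑ r ∈ Finset.range R, (-1 : ℝ) ^ r *
            (∑' k : ℕ, Real.exp (-(2 * a * digammaNode k)) * digammaNode k ^ (2 * r + 1)) / ω ^ (2 * r + 2)|
      ≤ (∑' k : ℕ, Real.exp (-(2 * a * digammaNode k)) * digammaNode k ^ (2 * R + 1)) / |ω| ^ (2 * R + 2) := by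
  have hωa : 0 < |ω| := abs_pos.2 hω
  have hψsum : ∀ r : ℕ, Summable fun k ↦ Real.exp (-(2 * a * digammaNode k)) *
      ((-1 : ℝ) ^ r * digammaNode k ^ (2 * r + 1) / ω ^ (2 * r + 2)) := by
    intro r
    refine ((summable_exp_mul_node_pow ha (2 * r + 1)).mul_left ((-1 : ℝ) ^ r / ω ^ (2 * r + 2))).congr fun k ↦ ?_
    ring
  have hcoef : ∀ r : ℕ, (-1 : ℝ) ^ r * (∑' k : ℕ, Real.exp (-(2 * a * digammaNode k)) * digammaNode k ^ (2 * r + 1))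
        / ω ^ (2 * r + 2)
      = ∑' k : ℕ, Real.exp (-(2 * a * digammaNode k)) *
          ((-1 : ℝ) ^ r * digammaNode k ^ (2 * r + 1) / ω ^ (2 * r + 2)) := by
    intro r
    rw [← tsum_mul_left, ← tsum_div_const]
    exact tsum_congr fun k ↦ by ring
  rw [Finset.sum_congr rfl fun r _ ↦ hcoef r]
  have hM : Summable fun k ↦ Real.exp (-(2 * a * digammaNode k)) * (digammaNode k ^ (2 * R + 1) / |ω| ^ (2 * R + 2)) := by
    refine ((summable_exp_mul_node_pow ha (2 * R + 1)).div_const (|ω| ^ (2 * R + 2))).congr fun k ↦ ?_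
    ring
  have h := abs_tsum_sub_sum_tsum_le (fun k ↦ Real.exp (-(2 * a * digammaNode k)))
    (fun k ↦ digammaNode k / (digammaNode k ^ 2 + ω ^ 2)) (fun k ↦ digammaNode k ^ (2 * R + 1) / |ω| ^ (2 * R + 2))
    (fun r k ↦ (-1 : ℝ) ^ r * digammaNode k ^ (2 * r + 1) / ω ^ (2 * r + 2)) R (fun k ↦ (Real.exp_pos _).le)
    (summable_exp_mul_node_div ha ω) hψsum hM (fun k ↦ abs_node_div_sub_sum_le hω (digammaNode_pos k) R)
  refine h.trans (le_of_eq ?_)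
  rw [← tsum_div_const]
  exact tsum_congr fun k ↦ by ring

/-! ## Enclosure of the node moments by partial sums -/

/-- `e^{−2al_{k+1}} = e^{−4a}·e^{−2al_k}` (`l_{k+1} = l_k + 2`). -/
theorem exp_node_succ (a : ℝ) (k : ℕ) :
    Real.exp (-(2 * a * digammaNode (k + 1))) = Real.exp (-(4 * a)) * Real.exp (-(2 * a * digammaNode k)) := by
  rw [← Real.exp_add]; congr 1; unfold digammaNode; push_cast; ring

/-- **Ratio bound for the moment terms**: for `i ≥ 0`,
`e^{−2al_{K+i}} l_{K+i}^s ≤ (e^{−4a}(1 + 2/l_K)^s)^i · e^{−2al_K} l_K^s`. -/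
theorem exp_mul_node_pow_shift_le (a : ℝ) (s K i : ℕ) :
    Real.exp (-(2 * a * digammaNode (K + i))) * digammaNode (K + i) ^ s
      ≤ (Real.exp (-(4 * a)) * (1 + 2 / digammaNode K) ^ s) ^ i * (Real.exp (-(2 * a * digammaNode K)) * digammaNode K ^ s) := by
  induction i with
  | zero => simp
  | succ i ih =>
      have hlK := digammaNode_pos K
      have hl := digammaNode_pos (K + i)
      have hmono : digammaNode K ≤ digammaNode (K + i) := by
        unfold digammaNode; push_cast; linarith [(Nat.cast_nonneg i : (0 : ℝ) ≤ i)]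
      -- one step: term_{K+i+1} = e^{−4a}((l+2)/l)^s · term_{K+i} ≤ q · term_{K+i}
      have hstep : Real.exp (-(2 * a * digammaNode (K + (i + 1)))) * digammaNode (K + (i + 1)) ^ s
          ≤ (Real.exp (-(4 * a)) * (1 + 2 / digammaNode K) ^ s)
            * (Real.exp (-(2 * a * digammaNode (K + i))) * digammaNode (K + i) ^ s) := by
        rw [show K + (i + 1) = (K + i) + 1 by ring, exp_node_succ,
          show digammaNode (K + i + 1) = digammaNode (K + i) + 2 by unfold digammaNode; push_cast; ring]
        have hratio : (digammaNode (K + i) + 2) ^ s ≤ (1 + 2 / digammaNode K) ^ s * digammaNode (K + i) ^ s := by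
          rw [← mul_pow]
          refine pow_le_pow_left₀ (by positivity) ?_ s
          rw [add_mul, one_mul, div_mul_eq_mul_div]
          have : 2 ≤ 2 * digammaNode (K + i) / digammaNode K := by
            rw [le_div_iff₀ hlK]; nlinarith
          linarith
        have hq0 : 0 ≤ Real.exp (-(4 * a)) := (Real.exp_pos _).le
        calc Real.exp (-(4 * a)) * Real.exp (-(2 * a * digammaNode (K + i))) * (digammaNode (K + i) + 2) ^ s
            ≤ Real.exp (-(4 * a)) * Real.exp (-(2 * a * digammaNode (K + i)))
                * ((1 + 2 / digammaNode K) ^ s * digammaNode (K + i) ^ s) :=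
              mul_le_mul_of_nonneg_left hratio (by positivity)
          _ = _ := by ring
      refine hstep.trans ?_
      rw [pow_succ]
      have hq0 : 0 ≤ Real.exp (-(4 * a)) * (1 + 2 / digammaNode K) ^ s := by positivity
      calc (Real.exp (-(4 * a)) * (1 + 2 / digammaNode K) ^ s)
            * (Real.exp (-(2 * a * digammaNode (K + i))) * digammaNode (K + i) ^ s)
          ≤ (Real.exp (-(4 * a)) * (1 + 2 / digammaNode K) ^ s)
            * ((Real.exp (-(4 * a)) * (1 + 2 / digammaNode K) ^ s) ^ i
              * (Real.exp (-(2 * a * digammaNode K)) * digammaNode K ^ s)) := mul_le_mul_of_nonneg_left ih hq0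
        _ = _ := by ring

/-- **Enclosure of `D_s(a)` by partial sums**: if `q := e^{−4a}(1 + 2/l_K)^s ≤ ½` then
`0 ≤ Σ_k e^{−2al_k} l_k^s − Σ_{k<K} e^{−2al_k} l_k^s ≤ 2 e^{−2al_K} l_K^s` (`a > 0`). -/
theorem tsum_exp_mul_node_pow_sub_sum_le (ha : 0 < a) (s K : ℕ)
    (hq : Real.exp (-(4 * a)) * (1 + 2 / digammaNode K) ^ s ≤ 1 / 2) :
    0 ≤ (∑' k : ℕ, Real.exp (-(2 * a * digammaNode k)) * digammaNode k ^ s)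
        - ∑ k ∈ Finset.range K, Real.exp (-(2 * a * digammaNode k)) * digammaNode k ^ s
    ∧ (∑' k : ℕ, Real.exp (-(2 * a * digammaNode k)) * digammaNode k ^ s)
        - ∑ k ∈ Finset.range K, Real.exp (-(2 * a * digammaNode k)) * digammaNode k ^ s
      ≤ 2 * (Real.exp (-(2 * a * digammaNode K)) * digammaNode K ^ s) := by
  have hsum := summable_exp_mul_node_pow ha s
  have htail : (∑' k : ℕ, Real.exp (-(2 * a * digammaNode k)) * digammaNode k ^ s)
        - ∑ k ∈ Finset.range K, Real.exp (-(2 * a * digammaNode k)) * digammaNode k ^ s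
      = ∑' i : ℕ, Real.exp (-(2 * a * digammaNode (i + K))) * digammaNode (i + K) ^ s := by
    rw [← hsum.sum_add_tsum_nat_add K]; ring
  have hsK : Summable fun i : ℕ ↦ Real.exp (-(2 * a * digammaNode (i + K))) * digammaNode (i + K) ^ s :=
    (summable_nat_add_iff K).2 hsum
  rw [htail]
  set q : ℝ := Real.exp (-(4 * a)) * (1 + 2 / digammaNode K) ^ s with hqdef
  set T : ℝ := Real.exp (-(2 * a * digammaNode K)) * digammaNode K ^ s with hT
  have hq0 : 0 ≤ q := by have := digammaNode_pos K; positivity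
  have hq1 : q < 1 := by linarith
  have hT0 : 0 ≤ T := by have := digammaNode_pos K; positivity
  have hle : ∀ i, Real.exp (-(2 * a * digammaNode (i + K))) * digammaNode (i + K) ^ s ≤ T * q ^ i := by
    intro i
    have h := exp_mul_node_pow_shift_le a s K i
    rw [add_comm K i] at h
    calc _ ≤ q ^ i * T := h
      _ = T * q ^ i := mul_comm _ _
  have hgeo : HasSum (fun i : ℕ ↦ T * q ^ i) (T * (1 - q)⁻¹) := (hasSum_geometric_of_lt_one hq0 hq1).mul_left T
  constructor
  · exact tsum_nonneg fun i ↦ by have := digammaNode_pos (i + K); positivity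
  · calc ∑' i : ℕ, Real.exp (-(2 * a * digammaNode (i + K))) * digammaNode (i + K) ^ s
        ≤ ∑' i : ℕ, T * q ^ i := hsK.tsum_le_tsum hle hgeo.summable
      _ = T * (1 - q)⁻¹ := hgeo.tsum_eq
      _ ≤ T * 2 := by
          refine mul_le_mul_of_nonneg_left ?_ hT0
          rw [inv_le_comm₀ (by linarith) (by norm_num)]; linarith
      _ = 2 * T := mul_comm _ _

/-! ## Real and imaginary parts of the expansion variable `(it)ⁿ` (for consumers of `WeilFormatCDigammaQuarterExpansion`) -/

/-- `iⁿ = i^{n mod 4}`. -/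
theorem I_pow_eq_I_pow_mod_four (n : ℕ) : Complex.I ^ n = Complex.I ^ (n % 4) := by
  conv_lhs => rw [← Nat.div_add_mod n 4]
  rw [pow_add, pow_mul, Complex.I_pow_four, one_pow, one_mul]

/-- `Re((it)ⁿ) = Re(iⁿ)·tⁿ` for real `t`. -/
theorem re_I_mul_ofReal_pow (t : ℝ) (n : ℕ) :
    ((Complex.I * (t : ℂ)) ^ n).re = (Complex.I ^ n).re * t ^ n := by
  rw [mul_pow, ← Complex.ofReal_pow, Complex.re_mul_ofReal]

/-- `Im((it)ⁿ) = Im(iⁿ)·tⁿ` for real `t`. -/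
theorem im_I_mul_ofReal_pow (t : ℝ) (n : ℕ) :
    ((Complex.I * (t : ℂ)) ^ n).im = (Complex.I ^ n).im * t ^ n := by
  rw [mul_pow, ← Complex.ofReal_pow, Complex.im_mul_ofReal]

end Summit.RiemannHypothesis.RiemannHypothesis.Theorems.WeilFormatC
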